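import Mathlib
import HarnessLib
import Summits.HubbardSuperconductivity.HubbardSuperconductivity.Theorems.KLProgrammePerturbedFermiCurveTower
import Summits.HubbardSuperconductivity.HubbardSuperconductivity.Theorems.KLProgrammeKLRegimeSplitTwoLegPieceFnEval
import Summits.HubbardSuperconductivity.HubbardSuperconductivity.Theorems.KLProgrammeKLRegimeCountertermMuFlow
import Summits.HubbardSuperconductivity.HubbardSuperconductivity.Theorems.KLProgrammeKLRegimeSplitTwoLegReductionsFn

/-!
# Route `KLProgramme` — ENGINE child (stmt-HubbardSuperconductivity-19855), two-leg SUPPLIER: the ANGULAR SIZES of the scale-increment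
# `δν = ν_{n'}(K) − ν_n(K)` of the local part from the coefficient MOMENTS of the lattice increment `Δσ = σ_{n'} − σ_n`, order by order,
# and the `hG` input of k3c3-p1's (E3a-V13) piece bound

Cell `gate-hubbard-kl`, seat hubbard-kl-k3c3-p3 (g3; row «implicit-function / monotonicity route»).  Gen 5 (plan g12 RULING l.1551, (R1)–(R3)):
the two-leg PIECES become the functions `klTwoLegPieceFn … K.eval (n+1) = klFrameExtFn μ (δν_{n+1})` (k3c3-p1 `klTwoLegPieceFn_eval_succ`),
whose momentum sizes (E3a-V13) are bounded by k3c3-p1's `norm_iteratedFDeriv_onM_klTwoLegPieceFn_eval_succ_le` LINEARLY in the angular sizes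
`G ≥ sup_{i≤j} ‖Dⁱ(δν_{n+1} − mean)‖`.  This module supplies `G` from ENGINE data:

* §1 `klLocalPart_sub_eq_evalM_comp`: `δν = evalM (symInterp L Δσ) ∘ γ_K` (same frame, same curve — the frame vertex `+K` inside `σ` CANCELS in
  the increment, so `Δσ` is genuine self-energy and its coefficient moments are the natural engine export (M1));
  `abs_sub_klAngularMean_le_of_deriv`: `|g − mean g| ≤ 2π·sup|g′|` (the CENTRED increment is slope-controlled, `O(U²)`).
* §2 `increment_angular_sizes_explicit` (regime, thresholds `klCurveC3 R` / `klCurveU0 R` of p485512): for an admissible frame with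
  order-3/4 sizes `A₃, A₄` and increment moments `m 0 … m 4`: `|δν| ≤ m 0`, `|∂δν| ≤ m1·D1`, `|∂²δν| ≤ m2·D1² + m1·D2`,
  `|∂³δν| ≤ m3·D1³ + 3m2·D1·D2 + m1·D3(A₃)`, `|∂⁴δν| ≤ m4·D1⁴ + 6m3·D1²D2 + 3m2·D2² + 4m2·D1·D3(A₃) + m1·D4(A₃,A₄)` (`D_i = klCurveD_i` of
  p486548: `D1, D2` ABSOLUTE — the increment keeps its scale grading at orders ≤ 2; `D3, D4` AFFINE in `A₃, A₄` — the multi-slot structure).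
* §3 `increment_centred_sizes_tier1`: the TIER-1 input ORDER-RESOLVED — `G₀ = 2m0`, `G₁ = (2π+1)·m1·D1`, `G₂ = G₁ + m2·D1² + m1·D2` bound
  `‖Dⁱ(δν_{n+1} − mean)‖` for `i ≤ j` — N-FREE, frame-allowance-free, no moment of order `> j`; and `twoLegPieceV13_tier1_size_le`: plugged
  into k3c3-p1's bound, the order-`j ≤ 2` momentum size of the V13 piece `onM (klTwoLegPieceFn … K.eval (n+1))` from `m 0 … m j` (the
  (E3a-V13) tier-1 SUPPLIER modulo the β-FREE package fit `… ≤ twoLegBar G Q U j (n+1)`).  Contrast p1b's `…_of_position_moments`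
  (`G = 4Mˢ₀ + 14·(Σ_{k≤4} Mˢ_k)·(max D 1)⁴`, one `G` for all `j`, `D = D(β)`): correct, but its fit into the β-free, `4^{(j−2)n}`-graded
  `twoLegBar` cannot hold at depth — the order resolution here is what makes the fit a condition on `S j` alone.

Proofs only; nothing is asserted about the Hubbard model.  References: BGM 2006 §2.4 (2.36), (2.40) [cite: BenfattoGiulianiMastropietro2006];
HOME/prover-p1b/g6/TWO-LEG-CLOSERS.md §1 (E3a-G) / §2 (M1); HOME/hubbard-kl-k3c3-p1/GEXT-SYMBOL.md «How the engine uses it».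
-/

noncomputable section

namespace Summit.HubbardSuperconductivity.HubbardSuperconductivity.Theorems.KLRegimeSplit

set_option linter.dupNamespace false -- summit = problem name (single-conjunct summit), D-0017

open Real Finset
open Literature.MathematicalPhysics.QuantumLattice Literature.Probability.LatticeModels
open Literature.MathematicalPhysics.QuantumLattice.FermiRG Literature.MathematicalPhysics.QuantumLattice.BandSectorCounting
open Summit.HubbardSuperconductivity.HubbardSuperconductivity.Theorems.KLProgrammeLegKernels
open Summit.HubbardSuperconductivity.HubbardSuperconductivity.Theorems.DispersionFlow
open Summit.HubbardSuperconductivity.HubbardSuperconductivity.Theorems.PerturbedFermiCurve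

/-! ## §1 The increment is the interpolant of the lattice increment read on the same curve -/

section Model

variable {L M : ℕ} [NeZero L] [NeZero M]

/-- **The local-part increment is the interpolant of the lattice increment read along the frame's curve**:
`ν_{n'}(K) − ν_n(K) = evalM (symInterp L (σ_{n'} − σ_n)) ∘ (toLp ∘ k_F^K)` (the frame vertex inside `σ` cancels). -/
theorem klLocalPart_sub_eq_evalM_comp (β U μ : ℝ) (K : TrigPolyC4v) (n n' : ℕ) :
    (fun θ => klLocalPart L M β U μ K n' θ - klLocalPart L M β U μ K n θ) =
      evalM (symInterp L fun k => klLocSelfEnergyRe L M β U μ K n' k - klLocSelfEnergyRe L M β U μ K n k) ∘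
        fun θ => (WithLp.toLp 2 (klFermiPoint μ K θ) : Momentum) := by
  funext θ
  simp only [Function.comp_apply, evalM, klLocalPart]
  rw [eval_symInterp_sub]

/-- **Sup of an interpolant from the zeroth moment**: `|(symInterp L f).eval p| ≤ m₀` (p1b's
`norm_iteratedFDeriv_evalM_symInterp_le_of_moments` at order `0`). -/
theorem abs_eval_symInterp_le_of_moment {f : TorusSite 2 L → ℝ} {m : ℝ}
    (hm : ∑ x : TorusSite 2 L, (1 + (x 0).valMinAbs.natAbs + (x 1).valMinAbs.natAbs : ℝ) ^ 0 * |torusCosCoeff L f x| ≤ m)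
    (p : Fin 2 → ℝ) : |(symInterp L f).eval p| ≤ m := by
  have h := norm_iteratedFDeriv_evalM_symInterp_le_of_moments (j := 0) hm (WithLp.toLp 2 p)
  rw [norm_iteratedFDeriv_zero, Real.norm_eq_abs] at h
  simpa [evalM] using h

/-- **Oscillation against the angular mean from a derivative bound**: a differentiable `2π`-periodic `g` with `|g′| ≤ Λ` satisfies
`|g t − mean g| ≤ 2π·Λ` at every `t` (the CENTRED profile is controlled by the slope — `O(U²)` for a two-leg increment — not by the
`O(|U|)` sup). -/
theorem abs_sub_klAngularMean_le_of_deriv {g : ℝ → ℝ} (hg : Differentiable ℝ g) (hper : Function.Periodic g (2 * π)) {Λ : ℝ}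
    (hΛ : ∀ θ, |deriv g θ| ≤ Λ) (t : ℝ) : |g t - klAngularMean g| ≤ 2 * π * Λ := by
  have hΛ0 : 0 ≤ Λ := (abs_nonneg _).trans (hΛ 0)
  have hlip : ∀ x y : ℝ, |g x - g y| ≤ Λ * |x - y| := by
    intro x y
    have h := Convex.norm_image_sub_le_of_norm_deriv_le (f := g) (s := Set.univ) (fun z _ => hg.differentiableAt)
      (fun z _ => by rw [Real.norm_eq_abs]; exact hΛ z) convex_univ (Set.mem_univ y) (Set.mem_univ x)
    simpa [Real.norm_eq_abs] using h
  have hp : (0 : ℝ) < 2 * π := by positivity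
  set t' := toIcoMod hp 0 t with ht'
  have hmem : t' ∈ Set.Ico (0 : ℝ) (2 * π) := toIcoMod_mem_Ico' hp t
  have hgt : g t' = g t := by
    rw [ht', ← self_sub_toIcoDiv_zsmul hp 0 t]; exact hper.sub_zsmul_eq _
  have hint : IntervalIntegrable g MeasureTheory.volume 0 (2 * π) := hg.continuous.intervalIntegrable _ _
  have hmean : klAngularMean (fun θ => g t' - g θ) = g t' - klAngularMean g := by
    rw [klAngularMean_sub intervalIntegrable_const hint, klAngularMean_const]
  rw [← hgt, ← hmean]
  refine abs_klAngularMean_le fun θ hθ => ?_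
  calc |g t' - g θ| ≤ Λ * |t' - θ| := hlip t' θ
    _ ≤ Λ * (2 * π) := by
        refine mul_le_mul_of_nonneg_left ?_ hΛ0
        rw [abs_le]; constructor <;> linarith [hmem.1, hmem.2, hθ.1, hθ.2]
    _ = 2 * π * Λ := by ring

end Model

/-! ## §2 The regime: angular sizes of the increment, order by order -/

section Regime

variable {L M : ℕ} [NeZero L] [NeZero M]

/-- **ANGULAR SIZES OF THE LOCAL-PART INCREMENT FROM INCREMENT MOMENTS.**  In the KL regime (`0 < c ≤ klCurveC3 R`, `0 < U ≤ klCurveU0 R`,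
`klBetaMin ≤ β ≤ e^{c/U²}`), for `μ ∈ klWindowC`, an admissible frame `FrameOK R U (nScales β) μ K` with ANY order-3/4 sizes
`A₃ ≥ ‖D³ frameShift K‖`, `A₄ ≥ ‖D⁴ frameShift K‖`, two scales `n, n'`, and coefficient moments of the lattice increment
`Δσ = σ_{n'} − σ_n` of orders `k ≤ 4` bounded by `m k`: with `δν = ν_{n'}(K) − ν_n(K)` and the curve sizes `klCurveD1/D2/D3 A₃/D4 A₃ A₄`,
`|δν| ≤ m 0`, `|∂δν| ≤ m1·D1`, `|∂²δν| ≤ m2·D1² + m1·D2`, `|∂³δν| ≤ m3·D1³ + 3m2·D1·D2 + m1·D3`,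
`|∂⁴δν| ≤ m4·D1⁴ + 6m3·D1²·D2 + 3m2·D2² + 4m2·D1·D3 + m1·D4`, and `δν` is `C⁴`. -/
theorem increment_angular_sizes_explicit {R : RenConsts} (hR : ∀ j, 0 ≤ R.Gfr j) {c : ℝ} (hc : 0 < c) (hcle : c ≤ klCurveC3 R)
    {U : ℝ} (hU : 0 < U) (hUle : U ≤ klCurveU0 R) {β : ℝ} (hβmin : klBetaMin ≤ β) (hβc : β ≤ Real.exp (c / U ^ 2))
    {μ : ℝ} (hμ : μ ∈ klWindowC) {K : TrigPolyC4v} (hK : FrameOK R U (nScales β) μ K)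
    {A₃ A₄ : ℝ} (hA₃ : ∀ p : Momentum, ‖iteratedFDeriv ℝ 3 (frameShift K) p‖ ≤ A₃)
    (hA₄ : ∀ p : Momentum, ‖iteratedFDeriv ℝ 4 (frameShift K) p‖ ≤ A₄)
    (β' : ℝ) (n n' : ℕ) {m : ℕ → ℝ}
    (hm : ∀ k ≤ 4, ∑ x : TorusSite 2 L, (1 + (x 0).valMinAbs.natAbs + (x 1).valMinAbs.natAbs : ℝ) ^ k *
      |torusCosCoeff L (fun k => klLocSelfEnergyRe L M β' U μ K n' k - klLocSelfEnergyRe L M β' U μ K n k) x| ≤ m k) (θ : ℝ) :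
    ContDiff ℝ 4 (fun θ => klLocalPart L M β' U μ K n' θ - klLocalPart L M β' U μ K n θ) ∧
    |klLocalPart L M β' U μ K n' θ - klLocalPart L M β' U μ K n θ| ≤ m 0 ∧
    |iteratedDeriv 1 (fun θ => klLocalPart L M β' U μ K n' θ - klLocalPart L M β' U μ K n θ) θ| ≤ m 1 * klCurveD1 ∧
    |iteratedDeriv 2 (fun θ => klLocalPart L M β' U μ K n' θ - klLocalPart L M β' U μ K n θ) θ| ≤
      m 2 * klCurveD1 ^ 2 + m 1 * klCurveD2 ∧
    |iteratedDeriv 3 (fun θ => klLocalPart L M β' U μ K n' θ - klLocalPart L M β' U μ K n θ) θ| ≤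
      m 3 * klCurveD1 ^ 3 + 3 * m 2 * klCurveD1 * klCurveD2 + m 1 * klCurveD3 A₃ ∧
    |iteratedDeriv 4 (fun θ => klLocalPart L M β' U μ K n' θ - klLocalPart L M β' U μ K n θ) θ| ≤
      m 4 * klCurveD1 ^ 4 + 6 * m 3 * klCurveD1 ^ 2 * klCurveD2 + 3 * m 2 * klCurveD2 ^ 2 + 4 * m 2 * klCurveD1 * klCurveD3 A₃ +
        m 1 * klCurveD4 A₃ A₄ := by
  set F := evalM (symInterp L fun k => klLocSelfEnergyRe L M β' U μ K n' k - klLocSelfEnergyRe L M β' U μ K n k) with hFdef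
  have hF : ContDiff ℝ 4 F := contDiff_evalM _
  have hcomp := klLocalPart_sub_eq_evalM_comp (L := L) (M := M) β' U μ K n n'
  rw [← hFdef] at hcomp
  have hγ := (fermiPointLp_sizes_explicit hR hc hcle hU hUle hβmin hβc hμ hK hA₃ hA₄ θ).1
  have hMk : ∀ k, 1 ≤ k → k ≤ 4 → ‖iteratedFDeriv ℝ k F (WithLp.toLp 2 (klFermiPoint μ K θ))‖ ≤ m k := fun k _ hk4 =>
    norm_iteratedFDeriv_evalM_symInterp_le_of_moments (hm k hk4) _
  obtain ⟨b1, b2, b3, b4⟩ := abs_iteratedDeriv_comp_fermiPointLp_le_struct hR hc hcle hU hUle hβmin hβc hμ hK hA₃ hA₄ hF θ hMk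
  refine ⟨?_, ?_, ?_, ?_, ?_, ?_⟩
  · rw [hcomp]; exact hF.comp hγ
  · have h0 := abs_eval_symInterp_le_of_moment (hm 0 (by norm_num)) (klFermiPoint μ K θ)
    have e : klLocalPart L M β' U μ K n' θ - klLocalPart L M β' U μ K n θ = F (WithLp.toLp 2 (klFermiPoint μ K θ)) := by
      have := congrFun hcomp θ; simpa using this
    rw [e]; simpa [hFdef, evalM] using h0
  · rw [hcomp]; exact b1
  · rw [hcomp]; exact b2
  · rw [hcomp]; exact b3
  · rw [hcomp]; exact b4

/-! ## §3 Tier 1 (`j ≤ 2`): the centred increment, N-free, and the V13 piece size -/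

/-- **TIER-1 ANGULAR SIZES OF THE CENTRED INCREMENT, ORDER-RESOLVED** (the `hG` hypothesis of k3c3-p1's piece bound): in the regime, for an
admissible frame and increment moments `m 0, m 1, m 2` of `Δσ = σ_{n+1} − σ_n` (orders `≤ 4` supplied, `3, 4` unused here), at every angle:
`|δν − mean| ≤ 2·m0` AND `≤ 2π·m1·D1` (sup vs slope control — the latter is `O(U²)`); for `i ≤ 1`: `‖Dⁱ(δν − mean)‖ ≤ (2π+1)·m1·D1`;
for `i ≤ 2`: `≤ (2π+1)·m1·D1 + (m2·D1² + m1·D2)` — ABSOLUTE curve constants `klCurveD1`, `klCurveD2` (no `N`, no frame allowance, no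
moment of order `> i`: the increment keeps its scale-`n` grading order by order). -/
theorem increment_centred_sizes_tier1 {R : RenConsts} (hR : ∀ j, 0 ≤ R.Gfr j) {c : ℝ} (hc : 0 < c) (hcle : c ≤ klCurveC3 R)
    {U : ℝ} (hU : 0 < U) (hUle : U ≤ klCurveU0 R) {β : ℝ} (hβmin : klBetaMin ≤ β) (hβc : β ≤ Real.exp (c / U ^ 2))
    {μ : ℝ} (hμ : μ ∈ klWindowC) {K : TrigPolyC4v} (hK : FrameOK R U (nScales β) μ K) (β' : ℝ) (n : ℕ) {m : ℕ → ℝ}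
    (hm : ∀ k ≤ 4, ∑ x : TorusSite 2 L, (1 + (x 0).valMinAbs.natAbs + (x 1).valMinAbs.natAbs : ℝ) ^ k *
      |torusCosCoeff L (fun k => klLocSelfEnergyRe L M β' U μ K (n + 1) k - klLocSelfEnergyRe L M β' U μ K n k) x| ≤ m k) (t : ℝ) :
    (‖iteratedFDeriv ℝ 0 (fun t => (klLocalPart L M β' U μ K (n + 1) t - klLocalPart L M β' U μ K n t) -
        klAngularMean (fun θ => klLocalPart L M β' U μ K (n + 1) θ - klLocalPart L M β' U μ K n θ)) t‖ ≤ 2 * m 0) ∧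
    (∀ i ≤ 1, ‖iteratedFDeriv ℝ i (fun t => (klLocalPart L M β' U μ K (n + 1) t - klLocalPart L M β' U μ K n t) -
        klAngularMean (fun θ => klLocalPart L M β' U μ K (n + 1) θ - klLocalPart L M β' U μ K n θ)) t‖ ≤
      (2 * π + 1) * (m 1 * klCurveD1)) ∧
    (∀ i ≤ 2, ‖iteratedFDeriv ℝ i (fun t => (klLocalPart L M β' U μ K (n + 1) t - klLocalPart L M β' U μ K n t) -
        klAngularMean (fun θ => klLocalPart L M β' U μ K (n + 1) θ - klLocalPart L M β' U μ K n θ)) t‖ ≤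
      (2 * π + 1) * (m 1 * klCurveD1) + (m 2 * klCurveD1 ^ 2 + m 1 * klCurveD2)) := by
  -- some order-3/4 sizes exist (only needed to invoke §2; tier 1 does not read them)
  obtain ⟨-, -, -, -, -, hA3f, hA4f⟩ := frame_sizes_of_frameOK_explicit hR hc hcle hU hUle hβmin hβc hμ hK
  set g := fun θ => klLocalPart L M β' U μ K (n + 1) θ - klLocalPart L M β' U μ K n θ with hg
  have H := fun θ => increment_angular_sizes_explicit (L := L) (M := M) hR hc hcle hU hUle hβmin hβc hμ hK hA3f hA4f β' n (n + 1) hm θ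
  have hC : ContDiff ℝ 4 g := (H t).1
  have hdiff : Differentiable ℝ g := hC.differentiable (by norm_num)
  have hper : Function.Periodic g (2 * π) := fun θ => by
    simp only [hg, klLocalPart_periodic β' U μ K (n + 1) θ, klLocalPart_periodic β' U μ K n θ]
  have h0 : ∀ θ, |g θ| ≤ m 0 := fun θ => (H θ).2.1
  have h1 : ∀ θ, |deriv g θ| ≤ m 1 * klCurveD1 := fun θ => by rw [← iteratedDeriv_one]; exact (H θ).2.2.1
  have hmean : |klAngularMean g| ≤ m 0 := abs_klAngularMean_le' h0
  have hosc : |g t - klAngularMean g| ≤ 2 * π * (m 1 * klCurveD1) := abs_sub_klAngularMean_le_of_deriv hdiff hper h1 t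
  have hB1 : 0 ≤ m 1 * klCurveD1 := (abs_nonneg _).trans (h1 t)
  have hB2 : 0 ≤ m 2 * klCurveD1 ^ 2 + m 1 * klCurveD2 := (abs_nonneg _).trans (H t).2.2.2.1
  have e1 : ∀ i, 0 < i → iteratedDeriv i (fun t => g t - klAngularMean g) t = iteratedDeriv i g t := fun i hi => by
    rw [show (fun t => g t - klAngularMean g) = fun t => -klAngularMean g + g t from funext fun t => by ring,
      iteratedDeriv_const_add hi]
  have hval : ∀ i ≤ 2, ‖iteratedFDeriv ℝ i (fun t => g t - klAngularMean g) t‖ =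
      |iteratedDeriv i (fun t => g t - klAngularMean g) t| := fun i _ => by
    rw [norm_iteratedFDeriv_eq_norm_iteratedDeriv, Real.norm_eq_abs]
  refine ⟨?_, fun i hi => ?_, fun i hi => ?_⟩
  · rw [hval 0 (by norm_num), iteratedDeriv_zero]
    exact (abs_sub _ _).trans (by linarith [h0 t])
  · rw [hval i (hi.trans (by norm_num))]
    interval_cases i
    · rw [iteratedDeriv_zero]; nlinarith [hosc, hB1]
    · rw [e1 1 one_pos]; nlinarith [(H t).2.2.1, hB1, Real.pi_pos]
  · rw [hval i hi]
    interval_cases i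
    · rw [iteratedDeriv_zero]; nlinarith [hosc, hB1, hB2]
    · rw [e1 1 one_pos]; nlinarith [(H t).2.2.1, hB1, hB2, Real.pi_pos]
    · rw [e1 2 two_pos]; nlinarith [(H t).2.2.2.1, hB1, Real.pi_pos]

/-- **(E3a-V13) TIER-1 SIZES OF THE PIECE FROM INCREMENT MOMENTS, ORDER-RESOLVED** — k3c3-p1's
`norm_iteratedFDeriv_onM_klTwoLegPieceFn_eval_succ_le` fed with the order-resolved envelopes: in the regime, for an admissible frame,
increment moments `m 0, m 1, m 2` of `Δσ_{n+1}` and a bound `X` on the cutoff profile's derivatives up to order `j ≤ 2`: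
`‖Dʲ onM (klTwoLegPieceFn L M β U μ K.eval (n+1)) q‖ ≤ [j=0]·m0 + (j!)²·(2·j!·X·200ʲ)·G_j·(4 + max 1 ((j−1)!/(8/5)))ʲ` with
`G₀ = 2·m0`, `G₁ = (2π+1)·m1·D1`, `G₂ = G₁ + m2·D1² + m1·D2` — every `G_j` involves only moments of order `≤ j` and the ABSOLUTE `D1, D2`,
so the fit into `twoLegBar G Q U j (n+1)` is a β-free condition on the package's `S j`. -/
theorem twoLegPieceV13_tier1_size_le {R : RenConsts} (hR : ∀ j, 0 ≤ R.Gfr j) {c : ℝ} (hc : 0 < c) (hcle : c ≤ klCurveC3 R)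
    {U : ℝ} (hU : 0 < U) (hUle : U ≤ klCurveU0 R) {β : ℝ} (hβmin : klBetaMin ≤ β) (hβc : β ≤ Real.exp (c / U ^ 2))
    {μ : ℝ} (hμ : μ ∈ klWindowC) {K : TrigPolyC4v} (hK : FrameOK R U (nScales β) μ K) (n : ℕ) {m : ℕ → ℝ}
    (hm : ∀ k ≤ 4, ∑ x : TorusSite 2 L, (1 + (x 0).valMinAbs.natAbs + (x 1).valMinAbs.natAbs : ℝ) ^ k *
      |torusCosCoeff L (fun k => klLocSelfEnergyRe L M β U μ K (n + 1) k - klLocSelfEnergyRe L M β U μ K n k) x| ≤ m k)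
    {j : ℕ} (hj : j ≤ 2) {X : ℝ} (hX : ∀ l ≤ j, ∀ x : ℝ, ‖iteratedFDeriv ℝ l salmhoferCutoff x‖ ≤ X) (q : Momentum) :
    ‖iteratedFDeriv ℝ j (onM (klTwoLegPieceFn L M β U μ K.eval (n + 1))) q‖ ≤
      (if j = 0 then m 0 else 0) +
        (j.factorial : ℝ) ^ 2 * (2 * j.factorial * X * 200 ^ j) *
          (if j = 0 then 2 * m 0 else (2 * π + 1) * (m 1 * klCurveD1) + (if j = 2 then m 2 * klCurveD1 ^ 2 + m 1 * klCurveD2 else 0)) *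
          (4 + max 1 (((j - 1).factorial : ℝ) / (8 / 5))) ^ j := by
  obtain ⟨hAf, hA20, hADt, -, ⟨hlo, hhi⟩, hA3f, hA4f⟩ := frame_sizes_of_frameOK_explicit hR hc hcle hU hUle hβmin hβc hμ hK
  have H := fun θ => increment_angular_sizes_explicit (L := L) (M := M) hR hc hcle hU hUle hβmin hβc hμ hK hA3f hA4f β n (n + 1) hm θ
  have hνC : ∀ k : ℕ, ContDiff ℝ 4 (klLocalPart L M β U μ K k) := fun k => by
    rw [klLocalPart_eq_comp]
    exact (contDiff_evalM _).comp (contDiff_four_fermiPointLp _ hAf hADt hlo hhi)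
  have h0 : ∀ θ, |klLocalPart L M β U μ K (n + 1) θ - klLocalPart L M β U μ K n θ| ≤ m 0 := fun θ => (H θ).2.1
  have hmean : |klAngularMean (fun θ => klLocalPart L M β U μ K (n + 1) θ - klLocalPart L M β U μ K n θ)| ≤ m 0 :=
    abs_klAngularMean_le' h0
  have E := fun t => increment_centred_sizes_tier1 (L := L) (M := M) hR hc hcle hU hUle hβmin hβc hμ hK β n hm t
  have key : ∀ {G : ℝ}, (∀ i ≤ j, ∀ t : ℝ, ‖iteratedFDeriv ℝ i (fun t =>
      (klLocalPart L M β U μ K (n + 1) t - klLocalPart L M β U μ K n t) -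
        klAngularMean (fun θ => klLocalPart L M β U μ K (n + 1) θ - klLocalPart L M β U μ K n θ)) t‖ ≤ G) →
      ‖iteratedFDeriv ℝ j (onM (klTwoLegPieceFn L M β U μ K.eval (n + 1))) q‖ ≤
        (if j = 0 then m 0 else 0) +
          (j.factorial : ℝ) ^ 2 * (2 * j.factorial * X * 200 ^ j) * G * (4 + max 1 (((j - 1).factorial : ℝ) / (8 / 5))) ^ j := by
    intro G hG
    have hmain := norm_iteratedFDeriv_onM_klTwoLegPieceFn_eval_succ_le (L := L) (M := M) K n (N := 4) (hνC (n + 1)) (hνC n)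
      (j := j) (by exact_mod_cast hj.trans (by norm_num : 2 ≤ 4)) hμ hG hX q
    refine hmain.trans (add_le_add ?_ le_rfl)
    split_ifs
    · exact hmean
    · exact le_rfl
  interval_cases j
  · simp only [↓reduceIte]
    exact (key (G := 2 * m 0) fun i hi t => by
      interval_cases i; exact (E t).1).trans (le_of_eq (by simp))
  · exact (key fun i hi t => (E t).2.1 i hi).trans (le_of_eq (by simp))
  · exact (key fun i hi t => (E t).2.2 i hi).trans (le_of_eq (by simp))

end Regime

end Summit.HubbardSuperconductivity.HubbardSuperconductivity.Theorems.KLRegimeSplit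

end
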